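import Summits.ResolutionOfSingularities.ResolutionOfSingularities.Theorems.MarkedTransferCampaignW46CuspStaircaseOverOrigin
import Literature.AlgebraicGeometry.Resolution.PlanePointBlowupChartTransfer
import Literature.AlgebraicGeometry.Hironaka2017.Lib.PlanePointBlowupAmbientDatum
import HarnessLib

/-!
# [OURS · L1 W4.6, rungs (iii)/(i-a)′] The cusp staircase climbs over EVERY field `K`: `⌊n/p⌋` attained, every centre over
# the origin, `β` unbounded at fixed coarse data — WITHOUT `[PerfectField K]`
# (cell res-hironaka, LADDER-RESOLUTION rung L, D-0089; slot W4.6; seat res-D-brk-2 (CONVERT pool, W4.6 desk's terms);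
# host route MarkedTransfer, `--kind proof --supports stmt-ResolutionOfSingularities-16155 --as helper`)

HONEST FRAMING. Everything below is OURS: kernel theorems about res-L1-s46-pv-1's résumé-free sequence types, pv-5's cusp
staircase and pv-13's scheme-level state `(𝔸²_K, E_n = ((y^p + xⁿ)·𝒪, p))`, built with the tree's REAL blow-up library and
this seat's every-field ambient files. NOTHING here is a statement of H. Hironaka's manuscript (2017-03-23, [Hironaka2017])
and nothing here asserts that any statement of it holds. No FACT-LIST premise. AI review is weaker than expert review.
No `sorry`; axioms standard; def-free.

## Why this file

pv-5's SHARPNESS (p503990) and this seat's β-price (p509474) carry `[PerfectField K]`, used only to make (a) the closed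
centres and (b) the blown-up ambient schemes SMOOTH over `K` via «regular ⇒ smooth». Over an imperfect `K` that fails in
general, but NOT on the staircase: every centre is the ORIGIN OF AN AFFINE-PLANE CHART over `K`, so (a) it is `K`-rational,
hence a permissible centre (`RationalPointCentre.isPermissibleCentre_singleton_of_isIso`), and (b) the blow-up is smooth
over `K` (`PlanePointBlowup.smooth_comp_of_hasPlaneChart`), and the new singular point again has a plane chart
(`PlanePointBlowup.hasPlaneChart_of_over`). This file runs that induction.

## What is proved (every prime `p`, EVERY field `K` of characteristic `p`)

* `Cusp.exists_pointBlowup_of_hasPlaneChart` — pv-5's `exists_pointBlowup` with `[PerfectField K]` replaced by a plane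
  chart at the closed singular point.
* `Cusp.exists_successor_over_chart` — one step with all the bookkeeping (transform standard and again a staircase state,
  dimension preserved, and for `2b < d` the new closed cusp point `ξ′` over `ξ`, of exponents `(b, d − b)`, WITH A PLANE CHART).
* `Cusp.exists_finPermissibleRun_over_chart` — the whole tower: for `L·b < d`, a finite §2.1-permissible sequence of length
  `L`, every stage a staircase state of the same dimension, every centre over `ξ`.
* **`CuspPlane.exists_finPermissibleRun_over_origin_allK`**, **`CuspPlane.isGreatest_len_allK`** — from K4.6's state over ANY
  field `K` of characteristic `p`: a sequence of length EXACTLY `n/p`, every stage in `Regime.cuspCurve` ∧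
  `regimePlaneIsolated` of the dimension of `𝔸²_K`, every centre over the origin; with pv-5's every-field upper bound
  `finPermissibleRun_len_le`: `n/p` is the GREATEST attained length.
* **`CuspPlane.le_beta_of_finLocalExitBound_clause_of_regime`**, **`CuspPlane.beta_unbounded_at_coarse_data_of_regime`** — the
  β-price and the RUNG-MAP WARNING «β is not a function of `(ord, b, dim)`», for EVERY field `K` of characteristic `p` and
  EVERY regime containing the staircase states of dimension `≤ 2` (both `regimePlaneIsolated` and `Regime.cuspCurve`).

## References

* res-L1-s46-pv-5 `…CuspStaircaseSharp.lean` (perfect-field template); this seat p505458/p506469/p507777/p508687/p509474/p511147/p512018.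
* The Stacks Project, Tags 0804, 01TB, 02OS. [cite: StacksProject, Tag 0804]
* H. Hironaka, ms. 2017-03-23, §2.1 p.4 l.35–39 — scope only, under adjudication. [Hironaka2017]
-/

noncomputable section

set_option linter.dupNamespace false -- mandated namespace of this single-conjunct summit
set_option backward.isDefEq.respectTransparency false

open CategoryTheory AlgebraicGeometry TopologicalSpace IsLocalRing

namespace Summit.ResolutionOfSingularities.ResolutionOfSingularities.Theorems

namespace CampaignW46

open Literature.AlgebraicGeometry.Resolution
open Literature.AlgebraicGeometry.Resolution.PlanePointBlowup
open Literature.AlgebraicGeometry.Hironaka2017.S02Preliminaries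
open Literature.AlgebraicGeometry.Hironaka2017.Datum
open Literature.AlgebraicGeometry.Hironaka2017.Lib.RationalPointCentre
open Scheme.IdealSheafData

universe u

namespace Cusp

section AllFields

variable {p : ℕ} [Fact p.Prime] {K : Type u} [Field K] [CharP K p]

/-- **A point with a plane chart is `K`-rational.** [folklore] -/
theorem isIso_fromSpecResidueField_comp_of_hasPlaneChart {Z : Scheme.{u}} (f : Z ⟶ Spec (.of K)) {x₀ : Z}
    (hc : HasPlaneChart f x₀) : IsIso (Z.fromSpecResidueField x₀ ≫ f) := by
  obtain ⟨V, hx₀V, e, he, hex₀⟩ := hc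
  haveI : IsIso ((P K).fromSpecResidueField (e.hom.base ⟨x₀, hx₀V⟩) ≫ PlanePointBlowup.f K) := by
    rw [hex₀]; exact isIso_fromSpecResidueField_ξ_comp K
  have h1 : IsIso ((V : Scheme.{u}).fromSpecResidueField ⟨x₀, hx₀V⟩ ≫ e.hom ≫ PlanePointBlowup.f K) :=
    (isIso_fromSpecResidueField_comp_iff_of_isOpenImmersion e.hom (PlanePointBlowup.f K) _).mpr inferInstance
  rw [he] at h1
  exact (isIso_fromSpecResidueField_comp_iff_of_isOpenImmersion V.ι f ⟨x₀, hx₀V⟩).mp h1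

/-- **Résumé-free step existence over EVERY field**: at a standard state `(A, E)` and a closed singular point `ξ` with
`{ξ} ≠ Z` admitting a PLANE CHART over `K`, the blow-up of `Z` at `ξ` exists as an ambient datum `A′` over `K`
(smooth by `PlanePointBlowup.smooth_comp_of_hasPlaneChart`), `{ξ}` is §2.1-permissible (`K`-rational:
`RationalPointCentre.isPermissibleCentre_singleton_of_isIso`), and the transform is standard. [folklore] -/
theorem exists_pointBlowup_of_hasPlaneChart (A : AmbientDatum p K) (E : IdealExponent A.Z) (hE : E.IsStandard) {ξ : A.Z}
    (hξcl : IsClosed ({ξ} : Set A.Z)) (hξS : ξ ∈ E.sing) (hne : ({ξ} : Set A.Z) ≠ Set.univ)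
    (hc : HasPlaneChart A.hom ξ) :
    ∃ (A' : AmbientDatum p K) (π : A'.Z ⟶ A.Z), A'.hom = π ≫ A.hom ∧
      IsBlowup π (vanishingIdeal (⟨{ξ}, hξcl⟩ : Closeds A.Z)) ∧ E.IsPermissibleCentre A.hom ⟨{ξ}, hξcl⟩ ∧
      (E.transform π ⟨{ξ}, hξcl⟩).IsStandard := by
  classical
  haveI := A.smooth
  haveI := A.irreducible
  haveI := A.quasiCompact
  haveI : IsLocallyNoetherian A.Z := ambient_isLocallyNoetherian A
  haveI : IsIntegral A.Z := ambient_isIntegral A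
  haveI := isIso_fromSpecResidueField_comp_of_hasPlaneChart A.hom hc
  let D : Closeds A.Z := ⟨{ξ}, hξcl⟩
  have hcentre : E.IsPermissibleCentre A.hom D := isPermissibleCentre_singleton_of_isIso A.hom E hξcl hξS
  have hπ : IsBlowup (blowup.π (vanishingIdeal D)) (vanishingIdeal D) := blowup.isBlowup _
  have hDtop : (vanishingIdeal D).support ≠ ⊤ := by
    intro h
    apply hne
    have := congrArg (fun S : Closeds A.Z => (S : Set A.Z)) h
    simpa [Scheme.IdealSheafData.coe_support_vanishingIdeal, D] using this
  haveI : Smooth (blowup.π (vanishingIdeal D) ≫ A.hom) := smooth_comp_of_hasPlaneChart hξcl hc hπ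
  haveI : IrreducibleSpace (blowup (vanishingIdeal D)) := irreducibleSpace_of_hasPlaneChart hξcl hc hπ
  haveI : QuasiCompact (blowup.π (vanishingIdeal D) ≫ A.hom) := quasiCompact_comp_of_isBlowup hπ
  let A' : AmbientDatum p K :=
    { Z := blowup (vanishingIdeal D), hom := blowup.π (vanishingIdeal D) ≫ A.hom, irreducible := inferInstance,
      smooth := inferInstance, quasiCompact := inferInstance }
  refine ⟨A', blowup.π (vanishingIdeal D), rfl, hπ, hcentre, ?_, hE.2⟩
  intro hbot
  apply hπ.comap_ne_bot hDtop hE.1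
  have hle : E.J.comap (blowup.π (vanishingIdeal D)) ≤ (E.transform (blowup.π (vanishingIdeal D)) D).J :=
    comap_le_controlledTransform _ (vanishingIdeal D) E.J E.b
  rw [hbot] at hle
  exact le_bot_iff.1 hle

/-- **One step of the staircase over EVERY field, with the bookkeeping «over ξ», «in the regime» and «plane chart».**
At a STAIRCASE state `(A, E)` with a closed cusp point `ξ` of exponents `(b, d)`, `b = E.b`, `b < d`, admitting a plane
chart: the blow-up of `{ξ}` exists as an ambient datum `A′`, `{ξ}` is §2.1-permissible, the transform is standard and again a
staircase state, `dim A′.Z = dim A.Z`, and if `2b < d` there is a CLOSED cusp point `ξ′` of exponents `(b, d − b)` for the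
transform with `π ξ′ = ξ` which again ADMITS A PLANE CHART (`PlanePointBlowup.hasPlaneChart_of_over`: it is `K`-rational by
pv-5's `residueField_map_stalkMap_surjective_of_le`). [folklore] -/
theorem exists_successor_over_chart (A : AmbientDatum p K) (E : IdealExponent A.Z) (hE : E.IsStandard)
    (hRg : Regime.cuspCurve (p := p) (K := K) A E) {ξ : A.Z} (hξcl : IsClosed ({ξ} : Set A.Z)) {d : ℕ} (hbd : E.b < d)
    (hshape : CuspShape E.b d (A.Z.presheaf.stalk ξ) (stalkIdeal E.J ξ)) (hc : HasPlaneChart A.hom ξ) :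
    ∃ (A' : AmbientDatum p K) (π : A'.Z ⟶ A.Z) (ξ' : A'.Z), A'.hom = π ≫ A.hom ∧
      IsBlowup π (vanishingIdeal (⟨{ξ}, hξcl⟩ : Closeds A.Z)) ∧ E.IsPermissibleCentre A.hom ⟨{ξ}, hξcl⟩ ∧
      (E.transform π ⟨{ξ}, hξcl⟩).IsStandard ∧ Regime.cuspCurve (p := p) (K := K) A' (E.transform π ⟨{ξ}, hξcl⟩) ∧
      topologicalKrullDim A'.Z = topologicalKrullDim A.Z ∧ IsClosed ({ξ'} : Set A'.Z) ∧
      (2 * E.b < d → π ξ' = ξ ∧ CuspShape E.b (d - E.b) (A'.Z.presheaf.stalk ξ')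
        (stalkIdeal (E.transform π ⟨{ξ}, hξcl⟩).J ξ') ∧ HasPlaneChart A'.hom ξ') := by
  classical
  have hξS : ξ ∈ E.sing := mem_sing_of_cuspShape hshape hbd.le
  obtain ⟨A', π, hhom, hπ, hperm, hstd⟩ :=
    exists_pointBlowup_of_hasPlaneChart A E hE hξcl hξS (singleton_ne_univ_of_cuspShape A hshape) hc
  haveI := A.smooth
  haveI := A'.smooth
  haveI : IsLocallyNoetherian A'.Z := ambient_isLocallyNoetherian A'
  haveI : JacobsonSpace A'.Z := ambient_jacobsonSpace A'
  haveI : JacobsonSpace A.Z := ambient_jacobsonSpace A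
  haveI : LocallyOfFiniteType π := by
    have h : LocallyOfFiniteType (π ≫ A.hom) := by
      rw [← hhom]
      infer_instance
    exact locallyOfFiniteType_of_comp π A.hom
  have hRg' : Regime.cuspCurve (p := p) (K := K) A' (E.transform π ⟨{ξ}, hξcl⟩) :=
    transform_cuspCurve hπ hhom hRg isIrreducible_singleton (Set.singleton_subset_iff.2 hξS)
  have hne : maximalIdeal (A.Z.presheaf.stalk ξ) ≠ ⊥ := by
    obtain ⟨-, hdim, -⟩ := hshape
    intro h
    rw [h, Submodule.spanFinrank_bot] at hdim
    exact absurd hdim (by decide)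
  have hdim : topologicalKrullDim A'.Z = topologicalKrullDim A.Z :=
    topologicalKrullDim_eq_of_blowup_closedPoint A A' hξcl hne hπ
  have hY : stalkIdeal (vanishingIdeal (⟨{ξ}, hξcl⟩ : Closeds A.Z)) ξ = maximalIdeal (A.Z.presheaf.stalk ξ) :=
    stalkIdeal_vanishingIdeal_singleton hξcl
  by_cases h2 : 2 * E.b < d
  · obtain ⟨hreg, hdim2, x, y, hxy, u, hu, hJ⟩ := hshape
    haveI := hreg
    obtain ⟨c, hc_def⟩ : ∃ c : Fin 2 → A.Z.presheaf.stalk ξ, c = ![x, y] := ⟨_, rfl⟩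
    have hc0 : c 0 = x := by rw [hc_def]; rfl
    have hc1 : c 1 = y := by rw [hc_def]; rfl
    have hcs : Ideal.span (Set.range c) = maximalIdeal _ := by rw [hc_def, MohWindow.range_vec2]; exact hxy
    have hJc : stalkIdeal E.J ξ = Ideal.span {c 1 ^ E.b + u * c 0 ^ d} := by rw [hJ, hc0, hc1]
    obtain ⟨x', hπx, hle⟩ := MohWindow.exists_le_idealOrder_controlledTransform_of_le hπ hE.2 h2.le hdim2 c hcs hY hJc
    have hshape0 : CuspShape E.b d (A.Z.presheaf.stalk (π x')) (stalkIdeal E.J (π x')) := by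
      rw [hπx]; exact ⟨hreg, hdim2, x, y, hxy, u, hu, hJ⟩
    have hY' : stalkIdeal (vanishingIdeal (⟨{ξ}, hξcl⟩ : Closeds A.Z)) (π x') =
        maximalIdeal (A.Z.presheaf.stalk (π x')) := by rw [hπx]; exact hY
    have hcl' : IsClosed ({π.base x'} : Set A.Z) := by
      have : π.base x' = ξ := hπx
      rw [this]; exact hξcl
    -- the new point is `K`-rational, hence has a plane chart
    have hsurj : Function.Surjective (π.residueFieldMap x') :=
      Cusp.residueField_map_stalkMap_surjective_of_le hπ hE.2 hbd hY' hshape0 hle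
    haveI : IsIso (A.Z.fromSpecResidueField (π.base x') ≫ A.hom) := by
      have : π.base x' = ξ := hπx
      rw [this]
      exact isIso_fromSpecResidueField_comp_of_hasPlaneChart A.hom hc
    haveI : IsIso (A'.Z.fromSpecResidueField x' ≫ π ≫ A.hom) :=
      isIso_fromSpecResidueField_comp_of_surjective π A.hom x' hsurj
    have hc' : HasPlaneChart A'.hom x' := by
      obtain ⟨V, hξV, e, he, heξ⟩ := hc
      rw [hhom]
      exact hasPlaneChart_of_over hξcl hξV e he heξ hπ hπx
    refine ⟨A', π, x', hhom, hπ, hperm, hstd, hRg', hdim,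
      Cusp.isClosed_singleton_of_le hπ hE.2 hbd hcl' hY' hshape0 hle, fun _ => ⟨hπx, ?_, hc'⟩⟩
    exact Cusp.cuspShape_transform_of_le hπ hE.2 hbd hY' hshape0 hle
  · haveI := A'.irreducible
    obtain ⟨x', -, hx'⟩ := nonempty_inter_closedPoints (Set.univ_nonempty (α := A'.Z))
      isClosed_univ.isLocallyClosed
    exact ⟨A', π, x', hhom, hπ, hperm, hstd, hRg', hdim, hx', fun h => absurd h h2⟩

/-- **THE STAIRCASE CLIMBED OVER `ξ`, EVERY FIELD `K`.** From a staircase state `(A, E)` with a closed cusp point `ξ` of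
exponents `(b, d)` admitting a plane chart, and every `L` with `L·b < d`: a finite §2.1-permissible sequence of length `L`
with `(r.A 0, r.E 0) = (A, E)`, every stage `k ≤ L` a staircase state with `dim (r.A k).Z = dim A.Z`, every centre over
`ξ`. [folklore] -/
theorem exists_finPermissibleRun_over_chart (L : ℕ) :
    ∀ (A : AmbientDatum p K) (E : IdealExponent A.Z), E.IsStandard → Regime.cuspCurve (p := p) (K := K) A E →
      ∀ {ξ : A.Z}, IsClosed ({ξ} : Set A.Z) → ∀ {d : ℕ},
        (E.b < d → CuspShape E.b d (A.Z.presheaf.stalk ξ) (stalkIdeal E.J ξ) ∧ HasPlaneChart A.hom ξ) → L * E.b < d →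
        ∃ r : FinPermissibleRun p K, r.len = L ∧
          (⟨r.A 0, r.E 0⟩ : Σ A : AmbientDatum p K, IdealExponent A.Z) = ⟨A, E⟩ ∧
          (∀ k, k ≤ r.len → Regime.cuspCurve (p := p) (K := K) (r.A k) (r.E k) ∧
            topologicalKrullDim (r.A k).Z = topologicalKrullDim A.Z) ∧
          ∃ x : (r.A 0).Z, (⟨r.A 0, x⟩ : Σ A : AmbientDatum p K, (A.Z : Type u)) = ⟨A, ξ⟩ ∧
            ∀ m, m < r.len → ∃ y ∈ (r.D m : Set (r.A m).Z), r.down m y = x := by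
  induction L with
  | zero =>
    intro A E hE hRg ξ hξcl d hshape hL
    exact ⟨FinPermissibleRun.nil A E hE, rfl, rfl, fun k hk => ⟨by
      obtain rfl : k = 0 := Nat.le_zero.mp hk; exact hRg, rfl⟩, ξ, rfl, fun m hm => absurd hm (Nat.not_lt_zero m)⟩
  | succ L ih =>
    intro A E hE hRg ξ hξcl d hshape hL
    have hbpos : 0 < E.b := hE.2
    have hbd : E.b < d := by
      have : E.b ≤ (L + 1) * E.b := Nat.le_mul_of_pos_left _ (Nat.succ_pos L)
      omega
    obtain ⟨A', π, ξ', hhom, hπ, hperm, hstd, hRg', hdim, hξ'cl, hnext⟩ :=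
      exists_successor_over_chart A E hE hRg hξcl hbd (hshape hbd).1 (hshape hbd).2
    have hb' : (E.transform π ⟨{ξ}, hξcl⟩).b = E.b := rfl
    have hshape' : (E.transform π ⟨{ξ}, hξcl⟩).b < d - E.b →
        CuspShape (E.transform π ⟨{ξ}, hξcl⟩).b (d - E.b) (A'.Z.presheaf.stalk ξ')
          (stalkIdeal (E.transform π ⟨{ξ}, hξcl⟩).J ξ') ∧ HasPlaneChart A'.hom ξ' := fun hlt => by
      have h2 : 2 * E.b < d := by rw [hb'] at hlt; omega
      exact ⟨(hnext h2).2.1, (hnext h2).2.2⟩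
    have hL' : L * (E.transform π ⟨{ξ}, hξcl⟩).b < d - E.b := by
      rw [hb']
      rw [Nat.succ_mul] at hL
      omega
    obtain ⟨r', hlen', hstart', hreg', x', hx', hover'⟩ := ih A' _ hstd hRg' hξ'cl hshape' hL'
    obtain ⟨hA', hE'⟩ := Sigma.mk.inj_iff.mp hstart'
    obtain ⟨hA'', hx''⟩ := Sigma.mk.inj_iff.mp hx'
    subst hA'
    have hsucc : r'.E 0 = E.transform π ⟨{ξ}, hξcl⟩ := eq_of_heq hE'
    have hxξ : x' = ξ' := eq_of_heq hx''
    refine ⟨r'.cons A E ⟨{ξ}, hξcl⟩ π hE hperm hhom hπ hsucc, by rw [FinPermissibleRun.cons_len, hlen'], rfl, ?_,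
      ξ, rfl, ?_⟩
    · refine FinPermissibleRun.cons_regime r' A E ⟨{ξ}, hξcl⟩ π hE hperm hhom hπ hsucc
        (Rg := fun A'' E'' => Regime.cuspCurve (p := p) (K := K) A'' E'' ∧
          topologicalKrullDim A''.Z = topologicalKrullDim A.Z) ⟨hRg, rfl⟩ fun k hk => ?_
      obtain ⟨h1, h2⟩ := hreg' k hk
      exact ⟨h1, h2.trans hdim⟩
    · by_cases h2 : 2 * E.b < d
      · have hπx : π x' = ξ := by rw [hxξ]; exact (hnext h2).1
        exact FinPermissibleRun.cons_over r' A E ⟨{ξ}, hξcl⟩ π hE hperm hhom hπ hsucc (Set.mem_singleton ξ) hπx hover'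
      · have hL0 : L = 0 := by
          by_contra hL0
          have : 1 ≤ L := Nat.one_le_iff_ne_zero.mpr hL0
          have : E.b ≤ L * E.b := Nat.le_mul_of_pos_left _ this
          rw [Nat.succ_mul] at hL
          omega
        intro m hm
        rw [FinPermissibleRun.cons_len, hlen', hL0] at hm
        obtain rfl : m = 0 := by omega
        exact ⟨ξ, Set.mem_singleton ξ, rfl⟩

end AllFields

end Cusp

/-! ## K4.6's family over EVERY field of characteristic `p` -/

namespace CuspPlane

open MvPolynomial
open Literature.AlgebraicGeometry.Hironaka2017.SpecOrders
open Literature.AlgebraicGeometry.Hironaka2017.S16Proof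

variable (p : ℕ) [Fact p.Prime] (K : Type u) [Field K] [CharP K p]

/-- The origin of K4.6's plane `U82Gap.amb p K = 𝔸²_K` has the tautological plane chart. [folklore] -/
theorem hasPlaneChart_origin : HasPlaneChart (U82Gap.amb p K).hom (U82Gap.ξ K) := hasPlaneChart_ξ K

/-- [OURS · L1 W4.6; NOT a statement of the manuscript] **The staircase from K4.6's state climbed OVER THE ORIGIN, EVERY
field `K` of characteristic `p`**: for `p < n`, `p ∤ n`, a finite §2.1-permissible sequence of length `n/p` from
`(𝔸²_K, E_n)` with every stage in `Regime.cuspCurve` AND in `regimePlaneIsolated` AND of the dimension of `𝔸²_K`, and every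
centre over the origin — no `[PerfectField K]` (the perfect-field statement without the dimension clause is
`exists_finPermissibleRun_over_origin`, p509474). [folklore] -/
theorem exists_finPermissibleRun_over_origin_allK {n : ℕ} (hpn : p < n) (hn : ¬ p ∣ n) :
    ∃ r : FinPermissibleRun p K, r.len = n / p ∧
      (⟨r.A 0, r.E 0⟩ : Σ A : AmbientDatum p K, IdealExponent A.Z) =
        ⟨U82Gap.amb p K, ⟨shf (MvPolynomial (Fin 2) K) (Ideal.span {X 1 ^ p + X 0 ^ n}), p⟩⟩ ∧
      (∀ k, k ≤ r.len → Regime.cuspCurve (p := p) (K := K) (r.A k) (r.E k) ∧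
        regimePlaneIsolated (p := p) (K := K) (r.A k) (r.E k) ∧
        topologicalKrullDim (r.A k).Z = topologicalKrullDim (U82Gap.amb p K).Z) ∧
      ∃ x : (r.A 0).Z, (⟨r.A 0, x⟩ : Σ A : AmbientDatum p K, (A.Z : Type u)) = ⟨U82Gap.amb p K, U82Gap.ξ K⟩ ∧
        ∀ m, m < r.len → ∃ y ∈ (r.D m : Set (r.A m).Z), r.down m y = x := by
  have hL : n / p * p < n := by
    rcases (Nat.div_mul_le_self n p).lt_or_eq with h | h
    · exact h
    · exact absurd (Dvd.intro_left _ h) hn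
  have hstd := isStandard p K (Nat.lt_of_le_of_lt (Nat.zero_le p) hpn)
  obtain ⟨r, hlen, hstart, hreg, x, hx, hover⟩ := Cusp.exists_finPermissibleRun_over_chart (n / p) (U82Gap.amb p K)
    ⟨shf (MvPolynomial (Fin 2) K) (Ideal.span {X 1 ^ p + X 0 ^ n}), p⟩ hstd (regime_cuspCurve p K hpn hn)
    (U82Gap.ξ_mem_closedPoints K) (fun _ => ⟨cuspShape_ξ p K n, hasPlaneChart_origin p K⟩) hL
  refine ⟨r, hlen, hstart, fun k hk => ?_, x, hx, hover⟩
  obtain ⟨hRg, hdim⟩ := hreg k hk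
  refine ⟨hRg, ⟨?_, hRg.2.1, hRg.2.2.1⟩, hdim⟩
  show topologicalKrullDim (r.A k).Z ≤ ((2 : ℕ) : WithBot ℕ∞)
  rw [hdim]
  exact LadderWitness.topologicalKrullDim_Z_le_two K

/-- [OURS · L1 W4.6 rung (iii); NOT a statement of the manuscript] **THE MAXIMAL LENGTH of a §2.1-permissible blow-up
sequence from K4.6's state `(𝔸²_K, ((y^p + xⁿ)·𝒪, p))` is EXACTLY `⌊n/p⌋` over EVERY field `K` of characteristic `p`**
(`p < n`, `p ∤ n`), as a greatest element of the set of attained lengths: attained (`exists_finPermissibleRun_over_origin_allK`)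
and never exceeded (pv-5's every-field `finPermissibleRun_len_le`). The perfect-field form is pv-5's
`finPermissibleRun_maxLen` (p503990). [folklore] -/
theorem isGreatest_len_allK {n : ℕ} (hpn : p < n) (hn : ¬ p ∣ n) :
    IsGreatest {L : ℕ | ∃ r : FinPermissibleRun p K, r.len = L ∧
      (⟨r.A 0, r.E 0⟩ : Σ A : AmbientDatum p K, IdealExponent A.Z) =
        ⟨U82Gap.amb p K, ⟨shf (MvPolynomial (Fin 2) K) (Ideal.span {X 1 ^ p + X 0 ^ n}), p⟩⟩} (n / p) := by
  refine ⟨?_, ?_⟩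
  · obtain ⟨r, hlen, hstart, -⟩ := exists_finPermissibleRun_over_origin_allK p K hpn hn
    exact ⟨r, hlen, hstart⟩
  · rintro L ⟨r, rfl, hstart⟩
    exact finPermissibleRun_len_le p K hpn hn r hstart

/-- Transport of a `β`-inequality along an equality of pointed states. [folklore] -/
private theorem le_beta_transport_allK (β : ∀ A : AmbientDatum p K, IdealExponent A.Z → A.Z → ℕ) {N : ℕ}
    (s t : Σ A : AmbientDatum p K, IdealExponent A.Z) (hst : s = t) (x : s.1.Z) (y : t.1.Z)
    (hxy : (⟨s.1, x⟩ : Σ A : AmbientDatum p K, (A.Z : Type u)) = ⟨t.1, y⟩) (h : N ≤ β s.1 s.2 x) : N ≤ β t.1 t.2 y := by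
  subst hst
  obtain ⟨-, hxy'⟩ := Sigma.mk.inj_iff.mp hxy
  rw [← eq_of_heq hxy']
  exact h

/-- [OURS · L1 W4.6 rung (i-a)′; NOT a statement of the manuscript] **THE PRICE OF `β`, EVERY field `K` of characteristic
`p`, for EVERY regime `Rg` containing the staircase states of dimension `≤ 2`** (e.g. `Rg := regimePlaneIsolated` with
`hRg := fun A E h hd => ⟨hd, h.2.1, h.2.2.1⟩`, or `Rg := Regime.cuspCurve`): every `β` satisfying the clause of
`FinLocalExitBound Rg` has `n/p ≤ β(𝔸²_K, E_n, ξ)` for `p < n`, `p ∤ n`. (Perfect-field forms for the two named regimes: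
`le_beta_of_finLocalExitBound_clause`, `…_cuspCurve`, p509474.) [folklore] -/
theorem le_beta_of_finLocalExitBound_clause_of_regime {n : ℕ} (hpn : p < n) (hn : ¬ p ∣ n) (Rg : Regime p K)
    (hRg : ∀ (A : AmbientDatum p K) (E : IdealExponent A.Z), Regime.cuspCurve (p := p) (K := K) A E →
      topologicalKrullDim A.Z ≤ ((2 : ℕ) : WithBot ℕ∞) → Rg A E)
    (β : ∀ A : AmbientDatum p K, IdealExponent A.Z → A.Z → ℕ)
    (hβ : ∀ r : FinPermissibleRun p K, (∀ k, k ≤ r.len → Rg (r.A k) (r.E k)) →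
      ∀ (x : (r.A 0).Z) (s : Finset ℕ),
        (∀ m ∈ s, m < r.len ∧ ∃ y ∈ (r.D m : Set (r.A m).Z), r.down m y = x) → s.card ≤ β (r.A 0) (r.E 0) x) :
    n / p ≤ β (U82Gap.amb p K) ⟨shf (MvPolynomial (Fin 2) K) (Ideal.span {X 1 ^ p + X 0 ^ n}), p⟩ (U82Gap.ξ K) := by
  obtain ⟨r, hlen, hstart, hreg, x, hx, hover⟩ := exists_finPermissibleRun_over_origin_allK p K hpn hn
  have key := hβ r (fun k hk => hRg _ _ (hreg k hk).1 (hreg k hk).2.1.1) x (Finset.range (n / p)) fun m hm => by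
    have hm' : m < r.len := by rw [hlen]; exact Finset.mem_range.mp hm
    exact ⟨hm', hover m hm'⟩
  rw [Finset.card_range] at key
  exact le_beta_transport_allK p K β _ _ hstart x (U82Gap.ξ K) hx key

/-- [OURS · L1 W4.6 rung (i-a)′; NOT a statement of the manuscript] **`β` IS UNBOUNDED AT FIXED COARSE DATA, EVERY field
`K` of characteristic `p`, EVERY regime `Rg` containing the staircase states of dimension `≤ 2`**: for every `β`
satisfying the clause of `FinLocalExitBound Rg` and every `M` there is an ideal exponent `E` on `𝔸²_K` with `E.b = p`,
`ord_ξ E.J = p`, `Sing(E) = {ξ}`, `dim 𝔸²_K ≤ 2` and `M ≤ β(𝔸²_K, E, ξ)`. (Perfect-field form for `regimePlaneIsolated`: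
`beta_unbounded_at_coarse_data`, p509474.) [folklore] -/
theorem beta_unbounded_at_coarse_data_of_regime (Rg : Regime p K)
    (hRg : ∀ (A : AmbientDatum p K) (E : IdealExponent A.Z), Regime.cuspCurve (p := p) (K := K) A E →
      topologicalKrullDim A.Z ≤ ((2 : ℕ) : WithBot ℕ∞) → Rg A E)
    (β : ∀ A : AmbientDatum p K, IdealExponent A.Z → A.Z → ℕ)
    (hβ : ∀ r : FinPermissibleRun p K, (∀ k, k ≤ r.len → Rg (r.A k) (r.E k)) →
      ∀ (x : (r.A 0).Z) (s : Finset ℕ),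
        (∀ m ∈ s, m < r.len ∧ ∃ y ∈ (r.D m : Set (r.A m).Z), r.down m y = x) → s.card ≤ β (r.A 0) (r.E 0) x)
    (M : ℕ) :
    ∃ E : IdealExponent (U82Gap.amb p K).Z, E.b = p ∧ idealOrder E.J (U82Gap.ξ K) = p ∧ E.sing = {U82Gap.ξ K} ∧
      topologicalKrullDim (U82Gap.amb p K).Z ≤ ((2 : ℕ) : WithBot ℕ∞) ∧ M ≤ β (U82Gap.amb p K) E (U82Gap.ξ K) := by
  have hp1 : 1 < p := (Fact.out : p.Prime).one_lt
  set n := (M + 1) * p + 1 with hn_def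
  have hpn : p < n := by
    have : p ≤ (M + 1) * p := Nat.le_mul_of_pos_left _ (Nat.succ_pos M)
    omega
  have hn : ¬ p ∣ n := by
    rintro ⟨c, hc⟩
    have h1 : p ∣ 1 := by
      refine ⟨c - (M + 1), ?_⟩
      rw [Nat.mul_sub, ← hc, hn_def, Nat.mul_comm]
      omega
    exact absurd (Nat.le_of_dvd one_pos h1) (not_le.mpr hp1)
  have hdiv : M ≤ n / p := by
    refine (Nat.le_div_iff_mul_le (Nat.lt_trans Nat.zero_lt_one hp1)).mpr ?_
    rw [hn_def, Nat.succ_mul]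
    omega
  refine ⟨⟨shf (MvPolynomial (Fin 2) K) (Ideal.span {X 1 ^ p + X 0 ^ n}), p⟩, rfl, ?_, sing_eq p K hpn.le hn,
    LadderWitness.topologicalKrullDim_Z_le_two K,
    hdiv.trans (le_beta_of_finLocalExitBound_clause_of_regime p K hpn hn Rg hRg β hβ)⟩
  exact idealOrder_ξ p K (n := n) hpn

end CuspPlane

end CampaignW46

end Summit.ResolutionOfSingularities.ResolutionOfSingularities.Theorems

end
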